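import Literature.MathematicalPhysics.QuantumFieldTheory.Balaban1983to89.B15Claim179
import Literature.MathematicalPhysics.QuantumFieldTheory.Balaban1983to89.B14FlowStep

/-!
# `Balaban1983to89.B15Claim179Flow` — [Balaban1989LargeFieldI] p. 179, the integer `N₀`: «either there is exactly one
# such integer, or there are two» PROVED ALONG A RENORMALIZATION GROUP FLOW of the setting of [III] §2
# (the hypotheses left open in `B15Claim179` — monotone unit steps of the sizes `R_j`, the gap hypothesis — DISCHARGED
# from (2.5)/(2.6)/(2.7) [III] and (0.20) [I] with `β ≥ 0`)

statement-level skeleton of published theorems with citation tags; proofs where landed; nothing here is a claim about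
the Yang–Mills mass gap.

CITATION HEADER (lean-in-tree rule 2026-08-18).  T. Bałaban, *Large field renormalization. I. The basic step of the 𝐑
operation*, Commun. Math. Phys. **122**, 175–202 (1989), doi:10.1007/BF01257412, bib `Balaban1989LargeFieldI` (cell
paper B15; PDF held `paper:balaban1989-cmp122-large-field-i`, journal page = PDF page + 174; p. 179 READ AS AN IMAGE on
the x2 render `…/1989-cmp122-large-field-I/1989-cmp122-large-field-I-p005-x2.png`).  [III] = [Balaban1988Convergent]
(cell paper B14): (2.5) p. 255 = `B14.IsRj` (*"R_j is the smallest number of the form L^r such, that R_j ≥ (log g_j⁻²)^r"*),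
(2.6)/(2.7) p. 255 = `B14.FlowIneq26`/`B14.FlowIneq27` and their derivation along a flow `B14FlowStep.flowIneq27_of_26`,
`B14.flowIneq26_of_rg_two_sided` under `B14FlowStep.SmallnessFor γ β′ β₀ L p` (what *"β₀ > 0 can be chosen arbitrarily
small, if γ is sufficiently small"* has to provide); [I] = [Balaban1987RG1] (0.20) p. 256 = `Flow.SatisfiesRG`
(`1/g_k² = 1/g_{k+1}² + β_{k+1}(g_k)`), monotone couplings from `β ≥ 0`: `B14FlowStep.g_mono_of_betaNonneg`.
WHAT IS REPRODUCED: SKELETON row `B15.Claim@179` (HOME `run/shared/lean/pub/lit-balaban/`, `lit-balaban-r12/ROWS-B15.md`),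
unit `lit-balaban-r12` gen 6 — the PROOF UPGRADE of the typed row (`B15Claim179`, p244714).

THE PRINTED TEXT (p. 179, verbatim): *"Take the smallest positive integer N₀ such, that L^{−N₀+1}MR_{k−N₀+1} = M. It is
easy to see that either there is exactly one such integer, or there are two."*

WHAT IS PROVED HERE (nothing typed anew; every declaration is a theorem).  `B15Claim179` typed the claim
(`Claim179 s k`: the solution set `sols s k` of `s_{k−N+1} = N − 1`, `1 ≤ N ≤ k`, has one or two elements, for sizes
`R_j = L^{s_j}`) and proved it from two hypotheses: `GapHyp s k` (⇐ the third member of (2.9) [III] given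
`(L+1)·2^{β₀} < L²`) and the monotone unit steps `s_j ∈ {s_{j+1}, s_{j+1}+1}` (NOT derived there).  Here both are
DERIVED for the sizes (2.5) of the couplings of ANY flow `F` satisfying (0.20) up to `K` with `0 < g_j ≤ γ`
(`Flow.InInterval`), `0 ≤ β_{j+1}(g_j) ≤ β′` and `SmallnessFor γ β′ β₀ L p`:
* `exp_anti` — the couplings increase along the flow (`g_m ≤ g_n`, `m ≤ n`, from `β ≥ 0`), so `(log g_j⁻²)^p`
  decreases and, by the MINIMALITY in (2.5), `s_n ≤ s_m`;
* `exp_le_succ` — one step: (2.7) `(log g_j⁻²)^p ≤ (1 + g_{j+1}²β′)^{β₀}(log g_{j+1}⁻²)^p` with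
  `(1 + g²β′)^{β₀} ≤ 1 + β₀ ≤ L` (Bernoulli, `γ²β′ ≤ 1`, `β₀ ≤ 1`), so again by minimality `s_j ≤ s_{j+1} + 1`;
* `exp_le_add_two` — two steps: `(1 + 2g²β′)^{β₀} ≤ 1 + 2β₀ ≤ 2 ≤ L` (`Lβ₀ ≤ 1`, the last member of (2.9)), so
  `s_j ≤ s_{j+2} + 1` — two consecutive unit steps never occur — whence `GapHyp` (`gapHyp_along_flow`) WITHOUT the
  extra `(L+1)·2^{β₀} < L²` of `B15Claim179.gapHyp_of_third_member` (which fails at `L = 2`, `β₀ = 1/2`);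
* `monoUnitSteps_along_flow`, `exists_sol_along_flow`, **`claim179_along_flow`** (the printed dichotomy) and
  `exists_isN0_along_flow` (`N₀` exists; every solution is `N₀` or `N₀+1`), for every `1 ≤ k ≤ K` such that the
  `R_1`-cubes are smaller than the lattice: `R_1 < L^k`, i.e. `s_1 + 1 ≤ k` (`fit_iff`).
HONEST SCOPE.  The sign `β ≥ 0` along the flow is the cell's standing unprinted input for all of (2.6)–(2.9)
(`B14FlowStep`, T09.F/T11.F); the hypothesis `R_1 < L^k` is the (unprinted, geometric) condition that a block of the
coarsest scale fits into the lattice `T_η`, `η = L^{−k}` — without it the equation can have no solution (all of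
`1, …, k` too small).  Integer/real bookkeeping only; the domains `Ω_j^{∼n}` are not modelled.  Value = the row's
printed sentence now holds as a theorem in the [III] flow setting the rest of the block uses; NOT summit progress.
-/

namespace Literature.MathematicalPhysics.QuantumFieldTheory.Balaban1983to89.B15Claim179Flow

open Literature.MathematicalPhysics.QuantumFieldTheory.Balaban1983to89
open B15Claim179 B14FlowStep

/-! ## A. Exponent bookkeeping from the minimality in (2.5) [III] -/

section Exponents

variable {L p : ℕ}

/-- (2.5) [III] gives `(log g⁻²)^p ≤ R = L^s`. [cite: Balaban1988Convergent, (2.5) p.255] -/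
theorem log_pow_le_of_isRj {g : ℝ} {s : ℕ} (h : B14.IsRj L p g (L ^ s)) :
    (Real.log (g ^ 2)⁻¹) ^ p ≤ ((L ^ s : ℕ) : ℝ) := by
  obtain ⟨_, _, hle, _⟩ := h
  exact hle

/-- The MINIMALITY in (2.5) [III]: if `(log g⁻²)^p ≤ L^{s′}` then the exponent of `R = L^s` satisfies `s ≤ s′`
(`L ≥ 2`, so the exponent of a power of `L` is unique). [cite: Balaban1988Convergent, (2.5) p.255] -/
theorem exp_le_of_isRj (hL : 2 ≤ L) {g : ℝ} {s s' : ℕ} (h : B14.IsRj L p g (L ^ s))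
    (hle : (Real.log (g ^ 2)⁻¹) ^ p ≤ ((L ^ s' : ℕ) : ℝ)) : s ≤ s' := by
  obtain ⟨s₀, hs₀, -, hmin⟩ := h
  have e : s = s₀ := Nat.pow_right_injective hL hs₀
  rw [e]
  exact hmin s' hle

/-- **The rounding step behind «easy to see» (p. 179).**  If `(log g_m⁻²)^p ≤ C·(log g_n⁻²)^p` with `0 ≤ C ≤ L`, then
the exponents of the sizes `R_m = L^{s_m}`, `R_n = L^{s_n}` of (2.5) satisfy `s_m ≤ s_n + 1`: `(log g_m⁻²)^p ≤ C·R_n ≤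
L·L^{s_n} = L^{s_n+1}` and minimality. [cite: Balaban1989LargeFieldI, p.179] -/
theorem exp_le_succ_of_log_le (hL : 2 ≤ L) {gm gn : ℝ} {sm sn : ℕ} (hm : B14.IsRj L p gm (L ^ sm))
    (hn : B14.IsRj L p gn (L ^ sn)) {C : ℝ} (hC0 : 0 ≤ C) (hCL : C ≤ L)
    (hcmp : (Real.log (gm ^ 2)⁻¹) ^ p ≤ C * (Real.log (gn ^ 2)⁻¹) ^ p) : sm ≤ sn + 1 := by
  have h1 := log_pow_le_of_isRj hn
  have hLs : (0 : ℝ) ≤ ((L ^ sn : ℕ) : ℝ) := by positivity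
  have h2 : (Real.log (gm ^ 2)⁻¹) ^ p ≤ ((L ^ (sn + 1) : ℕ) : ℝ) :=
    calc (Real.log (gm ^ 2)⁻¹) ^ p ≤ C * (Real.log (gn ^ 2)⁻¹) ^ p := hcmp
      _ ≤ C * ((L ^ sn : ℕ) : ℝ) := mul_le_mul_of_nonneg_left h1 hC0
      _ ≤ (L : ℝ) * ((L ^ sn : ℕ) : ℝ) := mul_le_mul_of_nonneg_right hCL hLs
      _ = ((L ^ (sn + 1) : ℕ) : ℝ) := by push_cast; ring
  exact exp_le_of_isRj hL hm h2

/-- **Monotonicity.**  For couplings `0 < g_m ≤ g_n ≤ 1` the exponents of (2.5) satisfy `s_n ≤ s_m` (`log g⁻²` is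
positive and decreasing in `g`, and `R_m = L^{s_m} ≥ (log g_m⁻²)^p ≥ (log g_n⁻²)^p`; minimality of `s_n`).
[cite: Balaban1989LargeFieldI, p.179] -/
theorem exp_anti_of_le (hL : 2 ≤ L) {gm gn : ℝ} {sm sn : ℕ} (hm : B14.IsRj L p gm (L ^ sm))
    (hn : B14.IsRj L p gn (L ^ sn)) (hgm : 0 < gm) (hmn : gm ≤ gn) (hn1 : gn ≤ 1) : sn ≤ sm := by
  have hbase : Real.log (gn ^ 2)⁻¹ ≤ Real.log (gm ^ 2)⁻¹ := log_inv_sq_mono hgm hmn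
  have h0 : 0 ≤ Real.log (gn ^ 2)⁻¹ := log_inv_sq_nonneg (lt_of_lt_of_le hgm hmn) hn1
  have hpow : (Real.log (gn ^ 2)⁻¹) ^ p ≤ (Real.log (gm ^ 2)⁻¹) ^ p := pow_le_pow_left₀ h0 hbase p
  exact exp_le_of_isRj hL hn (hpow.trans (log_pow_le_of_isRj hm))

/-- The two comparison constants of (2.7) [III] used below are at most `L` under `SmallnessFor`: one step,
`(1 + x)^{β₀} ≤ 1 + β₀x ≤ 2 ≤ L`, and two steps, `(1 + 2x)^{β₀} ≤ 1 + 2β₀x ≤ 1 + 2β₀ ≤ 2 ≤ L` (`0 ≤ x = g²β′ ≤ 1`,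
`0 < β₀ ≤ 1`, `Lβ₀ ≤ 1`; Bernoulli `rpow_one_add_le_one_add_mul_self`). [cite: Balaban1988Convergent, (2.7) p.255] -/
theorem one_add_mul_rpow_le_L {γ β' β₀ : ℝ} (S : SmallnessFor γ β' β₀ L p) {x : ℝ} (hx0 : 0 ≤ x) (hx1 : x ≤ 1)
    {c : ℝ} (hc0 : 0 ≤ c) (hc2 : c ≤ 2) : (1 + x * c) ^ β₀ ≤ (L : ℝ) := by
  have hβ0 := S.β₀_pos.le
  have hβ1 := S.β₀_le_one
  have hL2 : (2 : ℝ) ≤ L := by exact_mod_cast S.hL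
  have hLβ := S.h29c
  have hxc : 0 ≤ x * c := mul_nonneg hx0 hc0
  have hB : (1 + x * c) ^ β₀ ≤ 1 + β₀ * (x * c) :=
    rpow_one_add_le_one_add_mul_self (by linarith) hβ0 hβ1
  -- β₀ x c ≤ β₀ · 2 ≤ 1 (from L β₀ ≤ 1, L ≥ 2)
  have h1 : β₀ * (x * c) ≤ β₀ * 2 := by
    apply mul_le_mul_of_nonneg_left _ hβ0
    nlinarith
  have h2 : β₀ * 2 ≤ 1 := by nlinarith
  linarith

end Exponents

/-! ## B. Along a renormalization group flow of the [III] setting -/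

section AlongFlow

variable (F : Flow) (K : ℕ) {γ β' β₀ : ℝ} {L p : ℕ}

/-- Along a flow with `β ≥ 0` the exponents of the sizes (2.5) DECREASE (weakly) with the scale index: `s_n ≤ s_m` for
`m ≤ n ≤ K` (couplings increase, `B14FlowStep.g_mono_of_betaNonneg`; `g ≤ γ < 1`). [cite: Balaban1989LargeFieldI, p.179] -/
theorem exp_anti (S : SmallnessFor γ β' β₀ L p) (hrg : F.SatisfiesRG K) (hI : F.InInterval γ K)
    (hlb : ∀ j, j < K → 0 ≤ F.β (j + 1) (F.g j)) {s : ℕ → ℕ}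
    (hs : ∀ j, j ≤ K → B14.IsRj L p (F.g j) (L ^ s j)) {m n : ℕ} (hmn : m ≤ n) (hnK : n ≤ K) :
    s n ≤ s m := by
  have hpos : ∀ j, j ≤ K → 0 < F.g j := fun j hj => (hI j hj).1
  have hgm : 0 < F.g m := hpos m (hmn.trans hnK)
  have hg : F.g m ≤ F.g n := g_mono_of_betaNonneg F K hpos hrg hlb hmn hnK
  have hn1 : F.g n ≤ 1 := ((hI n hnK).2).trans S.γ_lt_one.le
  exact exp_anti_of_le S.hL (hs m (hmn.trans hnK)) (hs n hnK) hgm hg hn1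

/-- (2.7) [III] along the flow, second member, in the form used here: for `m < n ≤ K`,
`(log g_m⁻²)^p ≤ (1 + g_n²β′(n−m))^{β₀}(log g_n⁻²)^p` ((0.20) + `0 ≤ β ≤ β′` ⇒ (2.6) ⇒ (2.7),
`B14.flowIneq26_of_rg_two_sided` + `B14FlowStep.flowIneq27_of_26`). [cite: Balaban1988Convergent, (2.7) p.255] -/
theorem flow27b (S : SmallnessFor γ β' β₀ L p) (hrg : F.SatisfiesRG K) (hI : F.InInterval γ K)
    (hub : ∀ j, j < K → F.β (j + 1) (F.g j) ≤ β') (hlb : ∀ j, j < K → 0 ≤ F.β (j + 1) (F.g j))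
    {m n : ℕ} (hmn : m < n) (hnK : n ≤ K) :
    (Real.log ((F.g m) ^ 2)⁻¹) ^ p ≤
      (1 + (F.g n) ^ 2 * β' * ((n : ℝ) - m)) ^ β₀ * (Real.log ((F.g n) ^ 2)⁻¹) ^ p := by
  have hpos : ∀ j, j ≤ K → 0 < F.g j := fun j hj => (hI j hj).1
  have h26 := B14.flowIneq26_of_rg_two_sided F K β' β₀ S.β'_nonneg S.β₀_pos.le hpos hrg hub hlb
  have hI' : Step.InInterval γ K F.g := (Step.inInterval_iff F γ K).mp hI
  exact (flowIneq27_of_26 S hI' h26 m n hmn hnK).2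

/-- `0 ≤ g_n²β′ ≤ 1` along the flow (`g_n ≤ γ`, `γ²β′ ≤ 1`). [cite: Balaban1988Convergent, (2.7) p.255] -/
theorem sq_mul_beta'_mem (S : SmallnessFor γ β' β₀ L p) (hI : F.InInterval γ K) {n : ℕ} (hnK : n ≤ K) :
    0 ≤ (F.g n) ^ 2 * β' ∧ (F.g n) ^ 2 * β' ≤ 1 := by
  have hn : 0 < F.g n := (hI n hnK).1
  have hnγ : F.g n ≤ γ := (hI n hnK).2
  refine ⟨by have := S.β'_nonneg; positivity, ?_⟩
  have : (F.g n) ^ 2 ≤ γ ^ 2 := pow_le_pow_left₀ hn.le hnγ 2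
  have := mul_le_mul_of_nonneg_right this S.β'_nonneg
  linarith [S.h27c]

/-- **One step: at most one factor `L`.**  `s_j ≤ s_{j+1} + 1` for `j + 1 ≤ K` — from (2.7) at `(m, n) = (j, j+1)`
with `(1 + g_{j+1}²β′)^{β₀} ≤ L`, and the minimality in (2.5). [cite: Balaban1989LargeFieldI, p.179] -/
theorem exp_le_succ (S : SmallnessFor γ β' β₀ L p) (hrg : F.SatisfiesRG K) (hI : F.InInterval γ K)
    (hub : ∀ j, j < K → F.β (j + 1) (F.g j) ≤ β') (hlb : ∀ j, j < K → 0 ≤ F.β (j + 1) (F.g j))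
    {s : ℕ → ℕ} (hs : ∀ j, j ≤ K → B14.IsRj L p (F.g j) (L ^ s j)) {j : ℕ} (hj : j + 1 ≤ K) :
    s j ≤ s (j + 1) + 1 := by
  have h27 := flow27b F K S hrg hI hub hlb (Nat.lt_succ_self j) hj
  have e : ((j + 1 : ℕ) : ℝ) - (j : ℝ) = 1 := by push_cast; ring
  rw [e] at h27
  obtain ⟨hx0, hx1⟩ := sq_mul_beta'_mem F K S hI hj
  have hC := one_add_mul_rpow_le_L S hx0 hx1 (zero_le_one) (by norm_num : (1 : ℝ) ≤ 2)
  have hC0 : 0 ≤ (1 + (F.g (j + 1)) ^ 2 * β' * 1) ^ β₀ := by positivity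
  exact exp_le_succ_of_log_le S.hL (hs j (by omega)) (hs (j + 1) hj) hC0 hC h27

/-- **Two steps: still at most one factor `L`.**  `s_j ≤ s_{j+2} + 1` for `j + 2 ≤ K` — from (2.7) at `(m, n) = (j, j+2)`
with `(1 + 2g_{j+2}²β′)^{β₀} ≤ 1 + 2β₀ ≤ L` (this is where the last member `Lβ₀ ≤ 1` of (2.9) enters), and the
minimality in (2.5): two consecutive scales never both gain a factor `L`. [cite: Balaban1989LargeFieldI, p.179] -/
theorem exp_le_add_two (S : SmallnessFor γ β' β₀ L p) (hrg : F.SatisfiesRG K) (hI : F.InInterval γ K)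
    (hub : ∀ j, j < K → F.β (j + 1) (F.g j) ≤ β') (hlb : ∀ j, j < K → 0 ≤ F.β (j + 1) (F.g j))
    {s : ℕ → ℕ} (hs : ∀ j, j ≤ K → B14.IsRj L p (F.g j) (L ^ s j)) {j : ℕ} (hj : j + 2 ≤ K) :
    s j ≤ s (j + 2) + 1 := by
  have h27 := flow27b F K S hrg hI hub hlb (by omega : j < j + 2) hj
  have e : ((j + 2 : ℕ) : ℝ) - (j : ℝ) = 2 := by push_cast; ring
  rw [e] at h27
  obtain ⟨hx0, hx1⟩ := sq_mul_beta'_mem F K S hI hj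
  have hC := one_add_mul_rpow_le_L S hx0 hx1 (by norm_num : (0 : ℝ) ≤ 2) le_rfl
  have hC0 : 0 ≤ (1 + (F.g (j + 2)) ^ 2 * β' * 2) ^ β₀ := by positivity
  exact exp_le_succ_of_log_le S.hL (hs j (by omega)) (hs (j + 2) hj) hC0 hC h27

/-- **The monotone unit steps of `B15Claim179.exists_sol`, DERIVED**: along the flow, `s_j = s_{j+1}` or
`s_j = s_{j+1} + 1` for every `j < k ≤ K` (the sizes `R_j` of (2.5) grow toward the finer scales by at most one factor
`L` per step and never decrease). [cite: Balaban1989LargeFieldI, p.179] -/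
theorem monoUnitSteps_along_flow (S : SmallnessFor γ β' β₀ L p) (hrg : F.SatisfiesRG K) (hI : F.InInterval γ K)
    (hub : ∀ j, j < K → F.β (j + 1) (F.g j) ≤ β') (hlb : ∀ j, j < K → 0 ≤ F.β (j + 1) (F.g j))
    {s : ℕ → ℕ} (hs : ∀ j, j ≤ K → B14.IsRj L p (F.g j) (L ^ s j)) {k : ℕ} (hkK : k ≤ K) :
    ∀ j, 1 ≤ j → j < k → s j = s (j + 1) ∨ s j = s (j + 1) + 1 := by
  intro j _ hjk
  have h1 := exp_le_succ F K S hrg hI hub hlb hs (by omega : j + 1 ≤ K)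
  have h2 : s (j + 1) ≤ s j := exp_anti F K S hrg hI hlb hs (by omega : j ≤ j + 1) (by omega : j + 1 ≤ K)
  omega

/-- Unit steps summed: `s_a ≤ s_b + (b − a)` for `a ≤ b ≤ K`. [cite: Balaban1989LargeFieldI, p.179] -/
theorem exp_le_add_sub (S : SmallnessFor γ β' β₀ L p) (hrg : F.SatisfiesRG K) (hI : F.InInterval γ K)
    (hub : ∀ j, j < K → F.β (j + 1) (F.g j) ≤ β') (hlb : ∀ j, j < K → 0 ≤ F.β (j + 1) (F.g j))
    {s : ℕ → ℕ} (hs : ∀ j, j ≤ K → B14.IsRj L p (F.g j) (L ^ s j)) {a b : ℕ} (hab : a ≤ b) (hbK : b ≤ K) :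
    s a ≤ s b + (b - a) := by
  induction b, hab using Nat.le_induction with
  | base => simp
  | succ b hab ih =>
    have h1 := ih (by omega)
    have h2 := exp_le_succ F K S hrg hI hub hlb hs (by omega : b + 1 ≤ K)
    omega

/-- **`B15Claim179.GapHyp` DERIVED along the flow** (for every `k ≤ K`): over a gap of `n − m ≥ 2` scales the
exponent gains strictly fewer than `n − m` factors `L` — two steps give at most one (`exp_le_add_two`), the rest at
most one each.  No hypothesis `(L+1)·2^{β₀} < L²` is needed. [cite: Balaban1989LargeFieldI, p.179] -/
theorem gapHyp_along_flow (S : SmallnessFor γ β' β₀ L p) (hrg : F.SatisfiesRG K) (hI : F.InInterval γ K)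
    (hub : ∀ j, j < K → F.β (j + 1) (F.g j) ≤ β') (hlb : ∀ j, j < K → 0 ≤ F.β (j + 1) (F.g j))
    {s : ℕ → ℕ} (hs : ∀ j, j ≤ K → B14.IsRj L p (F.g j) (L ^ s j)) {k : ℕ} (hkK : k ≤ K) :
    GapHyp s k := by
  intro m n _ hmn hn hgap
  have h2 := exp_le_add_two F K S hrg hI hub hlb hs (by omega : m + 2 ≤ K)
  have h3 := exp_le_add_sub F K S hrg hI hub hlb hs (by omega : m + 2 ≤ n) (by omega : n ≤ K)
  omega

/-- The fitting condition in the two forms: `R_1 < L^k` (a block of the coarsest remembered scale is smaller than the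
lattice `T_η`, `η = L^{−k}`) iff `s_1 + 1 ≤ k`. [cite: Balaban1989LargeFieldI, p.179] -/
theorem fit_iff {L : ℕ} (hL : 2 ≤ L) (s : ℕ → ℕ) (k : ℕ) : L ^ s 1 < L ^ k ↔ s 1 + 1 ≤ k := by
  rw [Nat.pow_lt_pow_iff_right (by omega : 1 < L)]
  omega

/-- **EXISTENCE of `N₀` along the flow**: for `1 ≤ k ≤ K` with `R_1 < L^k` the equation `L^{N−1} = R_{k−N+1}` has a
solution `1 ≤ N ≤ k` (`B15Claim179.exists_sol` with its monotonicity hypothesis discharged by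
`monoUnitSteps_along_flow`). [cite: Balaban1989LargeFieldI, p.179] -/
theorem exists_sol_along_flow (S : SmallnessFor γ β' β₀ L p) (hrg : F.SatisfiesRG K) (hI : F.InInterval γ K)
    (hub : ∀ j, j < K → F.β (j + 1) (F.g j) ≤ β') (hlb : ∀ j, j < K → 0 ≤ F.β (j + 1) (F.g j))
    {s : ℕ → ℕ} (hs : ∀ j, j ≤ K → B14.IsRj L p (F.g j) (L ^ s j)) {k : ℕ} (hk : 1 ≤ k) (hkK : k ≤ K)
    (hfit : L ^ s 1 < L ^ k) : (sols s k).Nonempty :=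
  exists_sol hk (monoUnitSteps_along_flow F K S hrg hI hub hlb hs hkK) ((fit_iff S.hL s k).1 hfit)

/-- **p. 179 [Balaban1989LargeFieldI], «It is easy to see that either there is exactly one such integer, or there are
two» — PROVED along any renormalization group flow of the [III] setting**: (0.20) up to `K`, `0 < g_j ≤ γ`,
`0 ≤ β_{j+1}(g_j) ≤ β′`, `SmallnessFor γ β′ β₀ L p`, sizes `R_j = L^{s_j}` as in (2.5), for every `1 ≤ k ≤ K` with
`R_1 < L^k`. [cite: Balaban1989LargeFieldI, p.179] -/
theorem claim179_along_flow (S : SmallnessFor γ β' β₀ L p) (hrg : F.SatisfiesRG K) (hI : F.InInterval γ K)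
    (hub : ∀ j, j < K → F.β (j + 1) (F.g j) ≤ β') (hlb : ∀ j, j < K → 0 ≤ F.β (j + 1) (F.g j))
    {s : ℕ → ℕ} (hs : ∀ j, j ≤ K → B14.IsRj L p (F.g j) (L ^ s j)) {k : ℕ} (hk : 1 ≤ k) (hkK : k ≤ K)
    (hfit : L ^ s 1 < L ^ k) : Claim179 s k :=
  claim179_of (gapHyp_along_flow F K S hrg hI hub hlb hs hkK) (exists_sol_along_flow F K S hrg hI hub hlb hs hk hkK hfit)

/-- … and *"the smallest positive integer N₀"* exists, every solution being `N₀` or `N₀ + 1`.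
[cite: Balaban1989LargeFieldI, p.179] -/
theorem exists_isN0_along_flow (S : SmallnessFor γ β' β₀ L p) (hrg : F.SatisfiesRG K) (hI : F.InInterval γ K)
    (hub : ∀ j, j < K → F.β (j + 1) (F.g j) ≤ β') (hlb : ∀ j, j < K → 0 ≤ F.β (j + 1) (F.g j))
    {s : ℕ → ℕ} (hs : ∀ j, j ≤ K → B14.IsRj L p (F.g j) (L ^ s j)) {k : ℕ} (hk : 1 ≤ k) (hkK : k ≤ K)
    (hfit : L ^ s 1 < L ^ k) : ∃ N₀, IsN0 s k N₀ ∧ ∀ N ∈ sols s k, N = N₀ ∨ N = N₀ + 1 :=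
  exists_isN0 (gapHyp_along_flow F K S hrg hI hub hlb hs hkK) (exists_sol_along_flow F K S hrg hI hub hlb hs hk hkK hfit)

/-- The same from SIZES `R_j` given as natural numbers obeying (2.5) (as in `B14FlowStep.flowControl_of_betaSign`):
their exponents exist (`B15Claim179.exists_exp_of_isRj`), and for any choice of them the dichotomy holds.
[cite: Balaban1989LargeFieldI, p.179] -/
theorem claim179_of_sizes (S : SmallnessFor γ β' β₀ L p) (hrg : F.SatisfiesRG K) (hI : F.InInterval γ K)
    (hub : ∀ j, j < K → F.β (j + 1) (F.g j) ≤ β') (hlb : ∀ j, j < K → 0 ≤ F.β (j + 1) (F.g j))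
    (R : ℕ → ℕ) (hR : ∀ j, j ≤ K → B14.IsRj L p (F.g j) (R j)) {k : ℕ} (hk : 1 ≤ k) (hkK : k ≤ K)
    (hfit : R 1 < L ^ k) :
    ∃ s : ℕ → ℕ, (∀ j, j ≤ K → R j = L ^ s j) ∧ Claim179 s k := by
  classical
  -- choose exponents scale by scale (junk value 0 off the range, never used)
  have hex : ∀ j, ∃ sj : ℕ, j ≤ K → R j = L ^ sj := by
    intro j
    by_cases hj : j ≤ K
    · obtain ⟨sj, hsj⟩ := exists_exp_of_isRj (hR j hj)
      exact ⟨sj, fun _ => hsj⟩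
    · exact ⟨0, fun h => absurd h hj⟩
  choose s hs using hex
  refine ⟨s, hs, ?_⟩
  have hs' : ∀ j, j ≤ K → B14.IsRj L p (F.g j) (L ^ s j) := fun j hj => hs j hj ▸ hR j hj
  have hfit' : L ^ s 1 < L ^ k := by rw [← hs 1 (hk.trans hkK)]; exact hfit
  exact claim179_along_flow F K S hrg hI hub hlb hs' hk hkK hfit'

end AlongFlow

end Literature.MathematicalPhysics.QuantumFieldTheory.Balaban1983to89.B15Claim179Flow
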